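import Summits.Schanuel.Schanuel.Theorems.ZilberEacBranchOneDirection
import Summits.Schanuel.Schanuel.Theorems.ZilberEacBranchChartSecondCoefficient
import HarnessLib

/-!
# Arbitrary base branches, XXVI: growth from the SECOND phase coefficient — density in the
# residue class when the subleading Puiseux coefficient gives a non-real-killing direction

HONEST FRAMING.  Cell `pub-schanuel` (Zilber's Exponential-Algebraic Closedness, case ladder;
host summit Schanuel), seat 2, gen 28.  Files XIX–XXIII decide density from the TOP phase
coefficient `Π_M = Φ(0)z^M`; in the residue class (`Re Π_M = 0` for every root) they are silent.
With the closed form of the chart (XXIV: `m = z·s·G`, and `G′(0) = 0` when `k ≥ 2` —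
**`chart_closed_form_deriv_eq_zero`**) and the second coefficient (XXV: `Π_{M−1} = Φ′(0)z^{M−1}`),
THEOREM G applies as soon as `Re(Φ′(0)z^{M−1}) ≠ 0` for SOME `k`-th root `z` of `2πi`:
**`unprojectedDense_branch_growth_of_second_coeff`** (`k ≥ 2`, `M ≥ 2`, fibre value `ψ(0) ≠ 0`).
Example of what this decides: the diagonal parabola `(x₁ − x₀)² = x₀` (`x₀ = s^{-2}`,
`x₁ = (1 + s)s^{-2}`: `(k, M) = (2, 2)` is in the residue class, `Φ′(0) = 1`, `Re √(2πi) ≠ 0`) —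
a curve asymptotic to the RATIONAL direction `(1, 1)` whose constant fibres are nevertheless dense
(the case certificate for that curve is not in this file).  Decided instances of an OPEN question
(Mantova–Masser, PLMS 2024 §1 p. 5); EC(3,2) OPEN; NOT Schanuel's conjecture; EAC ⇏ SC.
-/

noncomputable section

open Filter Topology Polynomial Bornology Complex
open Literature.NumberTheory.Transcendental Literature.ModelTheory.Zilber
open Literature.ModelTheory.ExponentialFields

set_option linter.dupNamespace false

namespace Summit.Schanuel.Schanuel.Theorems

/-- **The closed-form factor of the chart is flat at `0` when `k ≥ 2`**: from
`G(s)^k(1 − s^k(log(ψ(s)/θ) + τ)) = 1` near `0`, `G(0) = 1` and `k ≥ 2`, `G′(0) = 0`. [folklore] -/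
theorem chart_closed_form_deriv_eq_zero {ψ : ℂ → ℂ} (hψ : AnalyticAt ℂ ψ 0) {θ : ℂ} (hθ0 : θ ≠ 0)
    (hψ0 : ψ 0 = θ) {τ : ℂ} {k : ℕ} (hk : 2 ≤ k) {G : ℂ → ℂ} (hGan : AnalyticAt ℂ G 0)
    (hG0 : G 0 = 1)
    (hGk : ∀ᶠ s in 𝓝 (0 : ℂ), G s ^ k * (1 - s ^ k * (Complex.log (ψ s / θ) + τ)) = 1) :
    deriv G 0 = 0 := by
  have hk0 : k ≠ 0 := by omega
  -- `Λ = log(ψ/θ)` is analytic at `0`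
  set Λ : ℂ → ℂ := fun s => Complex.log (ψ s / θ) with hΛ
  have hslit0 : ψ 0 / θ ∈ Complex.slitPlane := by
    rw [hψ0, div_self hθ0]; exact Complex.one_mem_slitPlane
  have hΛan : AnalyticAt ℂ Λ 0 := (hψ.div_const).clog hslit0
  -- `E = 1 − s^k(Λ + τ)` has `E(0) = 1`, `E′(0) = 0` (`k ≥ 2`)
  set A : ℂ → ℂ := fun s => Λ s + τ with hA
  have hAan : AnalyticAt ℂ A 0 := hΛan.add analyticAt_const
  have hE : HasDerivAt (fun s : ℂ => 1 - s ^ k * A s) 0 0 := by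
    have h1 : HasDerivAt (fun s : ℂ => s ^ k) (((k : ℕ) : ℂ) * (0 : ℂ) ^ (k - 1)) 0 :=
      hasDerivAt_pow k (0 : ℂ)
    have h2 : HasDerivAt A (deriv A 0) 0 := hAan.differentiableAt.hasDerivAt
    have h3 := h1.mul h2
    have h4 := (hasDerivAt_const (0 : ℂ) (1 : ℂ)).sub h3
    have h5 : HasDerivAt (fun s : ℂ => 1 - s ^ k * A s)
        (0 - (((k : ℕ) : ℂ) * (0 : ℂ) ^ (k - 1) * A 0 + (0 : ℂ) ^ k * deriv A 0)) 0 := by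
      simpa only [Pi.mul_def, Pi.sub_def] using h4
    refine h5.congr_deriv ?_
    rw [zero_pow (by omega : k - 1 ≠ 0), zero_pow hk0]
    ring
  -- differentiate `G^k · E = 1` at `0`
  have hGd : HasDerivAt G (deriv G 0) 0 := hGan.differentiableAt.hasDerivAt
  have hprod : HasDerivAt (fun s : ℂ => G s ^ k * (1 - s ^ k * A s))
      ((((k : ℕ) : ℂ) * G 0 ^ (k - 1) * deriv G 0) * (1 - (0 : ℂ) ^ k * A 0) + G 0 ^ k * 0) 0 := by
    have h := (hGd.pow k).mul hE
    simpa only [Pi.mul_def, Pi.pow_def] using h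
  have hconst : deriv (fun s : ℂ => G s ^ k * (1 - s ^ k * A s)) 0 = 0 := by
    have heq : (fun s : ℂ => G s ^ k * (1 - s ^ k * A s)) =ᶠ[𝓝 (0 : ℂ)] fun _ => (1 : ℂ) := by
      filter_upwards [hGk] with s hs
      simpa only [hA, hΛ] using hs
    rw [heq.deriv_eq, deriv_const]
  rw [hprod.deriv, hG0, zero_pow hk0] at hconst
  simp only [one_pow, zero_mul, sub_zero, mul_one, mul_zero, add_zero] at hconst
  have hkC : ((k : ℕ) : ℂ) ≠ 0 := Nat.cast_ne_zero.2 hk0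
  rcases mul_eq_zero.1 hconst with h | h
  · exact absurd h hkC
  · exact h

/-- **Growth from the second phase coefficient.**  A cylinder germ
`(s^{-k}, Φ(s)s^{-M}, ψ(s), e^{x₁})` (`k ≥ 2`, `M ≥ 2`, `ψ(0) ≠ 0`) in an irreducible closed `S` of
dimension `≤ 2` with `Re(Φ′(0)·z^{M−1}) ≠ 0` for SOME `k`-th root `z` of `2πi` gives Zariski-dense
exponential points: on the chart with tangent `z` (XIX) the phase polynomial has
`Π_{M−1} = Φ′(0)z^{M−1}` (XXIV, XXV), so `Re Π` is non-constant and THEOREM G applies.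
[cite: MantovaMasser2023, §1 Further remarks, p. 5 (the question, open in general)] (new) -/
theorem unprojectedDense_branch_growth_of_second_coeff {S : Set (Fin 2 ⊕ Fin 2 → ℂ)}
    (hS : IsIrreducibleClosed ℂ S) (hdim : zariskiDim ℂ S ≤ (2 : ℕ))
    {k M : ℕ} (hk : 2 ≤ k) (hM : 2 ≤ M) {ψ : ℂ → ℂ} (hψ : AnalyticAt ℂ ψ 0) {θ : ℂ} (hθ0 : θ ≠ 0)
    (hψ0 : ψ 0 = θ) {Φ : ℂ → ℂ} (hΦ : AnalyticAt ℂ Φ 0)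
    (hdir : ∃ z : ℂ, z ^ k = 2 * Real.pi * I ∧ (deriv Φ 0 * z ^ (M - 1)).re ≠ 0)
    (hgerm : ∀ᶠ s in 𝓝[≠] (0 : ℂ),
      (Sum.elim ![(s ^ k)⁻¹, Φ s * (s ^ M)⁻¹] ![ψ s, Complex.exp (Φ s * (s ^ M)⁻¹)] :
        Fin 2 ⊕ Fin 2 → ℂ) ∈ S) :
    UnprojectedDense S := by
  classical
  obtain ⟨z, hz, hzre⟩ := hdir
  have hk1 : 1 ≤ k := by omega
  -- `θ = e^τ`; chart WITH TANGENT `z`; witness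
  set τ : ℂ := Complex.log θ with hτdef
  have hτ : Complex.exp τ = θ := Complex.exp_log hθ0
  obtain ⟨m, hman, hm0, hmz, hchart⟩ := exists_ramifiedChart_root hψ hθ0 hψ0 τ hk1 hz
  have h2πI : (2 * Real.pi * I : ℂ) ≠ 0 := by simp [Real.pi_ne_zero, Complex.I_ne_zero]
  have hz0 : z ≠ 0 := by
    rintro rfl
    rw [zero_pow (by omega)] at hz
    exact h2πI hz.symm
  have hm' : deriv m 0 ≠ 0 := by rw [hmz]; exact hz0
  obtain ⟨U, r, Pl, m₀, μ, σ, hUan, -, hran, hPldeg, hPlM, hside, hμ0, hμ, -, hGσ, hxU, hexpσ, hnorm,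
      -, hid₁⟩ :=
    exists_ramified_witness_branch hθ0 hτ hk1 hgerm hman hm0 hm' hchart hΦ M
  -- the closed form of THIS chart and the second coefficient `Π_{M−1} = Φ′(0)z^{M−1}`
  obtain ⟨G, hGan, hG0, hGk, hmG⟩ := chart_closed_form hψ hθ0 hψ0 hk1 hman hm0 hchart
  have hG1 : deriv G 0 = 0 := chart_closed_form_deriv_eq_zero hψ hθ0 hψ0 hk hGan hG0 hGk
  rw [hmz] at hmG
  obtain ⟨N, rfl⟩ : ∃ N, M = N + 1 := ⟨M - 1, by omega⟩
  have hN : 1 ≤ N := by omega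
  have hcoeff : Pl.coeff N = deriv Φ 0 * z ^ N :=
    laurentPart_coeff_pred_eq hz0 hGan hG0 hG1 hmG hΦ hN hPldeg hran (hside.mono fun s h => h.2)
  have hre : (Pl.coeff N).re ≠ 0 := by
    rw [hcoeff]
    simpa using hzre
  -- the points
  set q : ℕ → Fin 2 ⊕ Fin 2 → ℂ := fun j =>
    Sum.elim ![(σ j ^ k)⁻¹, Φ (σ j) * (σ j ^ (N + 1))⁻¹]
      ![ψ (σ j), Complex.exp (Φ (σ j) * (σ j ^ (N + 1))⁻¹)] with hq
  have hqS : ∀ j, q j ∈ S := fun j => hGσ j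
  have hqΓ : ∀ j, q j ∈ expGraph ℂ 2 := by
    intro j
    rw [mem_expGraph_iff]
    intro i
    rw [Literature.ModelTheory.ExponentialFields.ExponentialRing.complex_exp_eq]
    fin_cases i
    · simp [hq, hexpσ j]
    · simp [hq]
  have hid : ∀ j, q j (Sum.inl 1) = Pl.eval ((m₀ + j : ℕ) : ℂ) + r (μ j) := fun j => by
    simp only [hq, Sum.elim_inl, Matrix.cons_val_one, Matrix.cons_val_zero]
    exact hid₁ j
  -- GROWTH (as in files XV, XIX, with `Re Π_N ≠ 0`, `N ≥ 1`)
  obtain ⟨gR, gI, hgR, -⟩ := exists_re_im_polynomials Pl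
  have hgRdeg : 1 ≤ gR.natDegree := le_trans hN (le_natDegree_rePoly hgR hre)
  have hcast : ∀ j, ((m₀ + j : ℕ) : ℂ) = (((m₀ + j : ℕ) : ℝ) : ℂ) := fun j => by
    rw [Complex.ofReal_natCast]
  have hrlim : Tendsto (fun j => r (μ j)) atTop (𝓝 (r 0)) := hran.continuousAt.tendsto.comp hμ
  have hreq : ∀ j, (q j (Sum.inl 1)).re = gR.eval ((m₀ + j : ℕ) : ℝ) + (r (μ j)).re := by
    intro j
    rw [hid j, Complex.add_re, hcast, hgR]
  obtain ⟨B, hB⟩ : ∃ B : ℝ, ∀ j, ‖r (μ j)‖ ≤ B := by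
    obtain ⟨C, hC⟩ := isBounded_iff_forall_norm_le.1 (Metric.isBounded_range_of_tendsto _ hrlim)
    exact ⟨C, fun j => hC _ ⟨j, rfl⟩⟩
  have hB0 : 0 ≤ B := (norm_nonneg _).trans (hB 0)
  have ha : ∀ j, |(q j (Sum.inl 1)).re - gR.eval ((m₀ + j : ℕ) : ℝ)| ≤ B := by
    intro j
    rw [hreq j, add_sub_cancel_left]
    exact (Complex.abs_re_le_norm _).trans (hB j)
  obtain ⟨D, hD, hLD⟩ := log_two_add_norm_eval_le_log_label Pl (le_refl (0 : ℝ))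
  have hLD' : ∀ j, Real.log (2 + ‖q j (Sum.inl 1)‖) ≤
      (D + Real.log (1 + B)) * Real.log (3 + 3 * ((m₀ + j : ℕ) : ℝ)) := by
    intro j
    have hlab0 : (0 : ℝ) ≤ ((m₀ + j : ℕ) : ℝ) := Nat.cast_nonneg _
    have h1 : Real.log (2 + ‖Pl.eval ((m₀ + j : ℕ) : ℂ)‖) ≤
        D * Real.log (3 + 3 * ((m₀ + j : ℕ) : ℝ)) := by
      refine hLD _ _ hlab0 ?_
      rw [Complex.norm_natCast, zero_add]
      linarith
    have h2 : ‖q j (Sum.inl 1)‖ ≤ ‖Pl.eval ((m₀ + j : ℕ) : ℂ)‖ + B := by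
      rw [hid j]
      exact (norm_add_le _ _).trans (by linarith [hB j])
    calc Real.log (2 + ‖q j (Sum.inl 1)‖)
        ≤ Real.log (2 + ‖Pl.eval ((m₀ + j : ℕ) : ℂ)‖ + B) :=
          Real.log_le_log (by positivity) (by linarith)
      _ ≤ (D + Real.log (1 + B)) * Real.log (3 + 3 * ((m₀ + j : ℕ) : ℝ)) :=
          log_two_add_add_le (norm_nonneg _) hB0 (one_le_log_three_add _ hlab0) h1
  have hD' : 0 < D + Real.log (1 + B) := by
    have := Real.log_nonneg (by linarith : (1 : ℝ) ≤ 1 + B)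
    linarith
  have hgr : Tendsto (fun j => |(q j (Sum.inl 1)).re| / Real.log (2 + ‖q j (Sum.inl 1)‖))
      atTop atTop :=
    tendsto_abs_div_log_of_linear_growth hgRdeg m₀ hD' ha
      (fun j => Real.log_le_log two_pos (by linarith [norm_nonneg (q j (Sum.inl 1))])) hLD'
  exact unprojectedDense_of_growth hS hdim 1 hqS hqΓ hgr

end Summit.Schanuel.Schanuel.Theorems

end
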